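/-
Copyright (c) 2026 the pub-hodgecm-mathlib formalisation cell (harness21).  Prover seat hodgecm-mathlib-K2Liu-p10 (g7) (S8 hand), Track B ∕ K2-LIT,
h413 = `stmt-HodgeConjecture-24833`, R90-TF section S8 «ContSpec-n½», the (M) «middle residue» road, FACT-N (c) «the local intertwiner at `v ∣ 𝔫`» —
THE SLOT ADAPTER (S8 dealer R90-CS-plan (g4), S8-R254 (2); census 2026-09-05T03:38Z on the R90 bus).  THEOREMS ONLY (no `def`, no instance, no notation, no `sorry`).
-/
import Summits.HodgeConjecture.HodgeConjecture.Theorems.R90S8IntertwiningKernelImageOfOrientationU3   -- ★ p865001 (this seat): `sub_quotient_of_keysOrientation`, `intertwiningMap_ker_quotient_of_keysOrientation`, `ker_ne_bot_of_not_injective`, `ker_ne_top_of_ne_zero` (+ ★ Literature `KeysOrientation`)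
import HarnessLib

/-!
# S8 (M) road, FACT-N (c): THE LOCAL INTERTWINER AT A RAMIFIED PLACE — the slot adapter.  From ORIENT and «the target has no subrepresentation of class `π²(ξ_v)`»,
# every NON-ZERO intertwining map `N_v` out of `i_G(χ_ξ)` is NON-INJECTIVE, hence `⊥ ≠ ker N_v ≠ ⊤`, `ker N_v ↦ π²(ξ_v)`, `i_G(χ_ξ) ⧸ ker N_v ↦ πⁿ(ξ_v)`

Track B ∕ K2-LIT, crux h413 = `stmt-HodgeConjecture-24833`, route of record `HCCMUnconditional`; cell `hodgecm-mathlib`, R90-TF programme, section S8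
«ContSpec-n½», the (M) «middle residue» road of socket B ED. 7 :299; J-S8-FN (c) (dealer R90-CS-plan (g4), S8-R254 (2)); consumer slot ★ p864867
`R90S8IntertwiningResidueKernelOfFactorisationU3` (LH4-p10 (g9): the local factor `Nv : Vv →ₗ Wv` is read only through `Nv ≠ 0`, `ker Nv ≠ ⊥`, `ker Nv ≠ ⊤`,
`Vv ⧸ ker Nv`), line-7 packaging K2E1-p10 (g6).  Lane `--supports stmt-HodgeConjecture-24833 --as helper` (count-neutral).  CLOSES NO SOCKET.

CENSUS (03:38Z).  At a ramified non-split place `v ∣ 𝔫` the slot wants the residual-point local factor `N_v(3∕2)` with: (i) the operator itself (+ its `z`-family,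
holomorphic on `{1 < Re}`) — genuinely LOCAL-ANALYTIC and ABSENT from the tree (the rank-one `U(2,1)(L⁺_v)` intertwining integral on `cmPrincipalSeries`-sections;
★ `K2Lit.localIntertwining` is the doubled group's Siegel parabolic, ★ `K2E1ChiIntertwiningLocalScalarU3` the unramified spherical scalar); (ii) `N_v(3∕2) ≠ 0` —
local-analytic after (i); (iii) `⊥ ≠ ker N_v(3∕2)` — ALGEBRAIC modulo one target letter; kernel ∕ quotient identification — ★ p865001.  THIS FILE is the adapter,
HYPOTHESIS-FIRST on exactly the analytic letters {the operator `f : (cmPrincipalSeries L 3 v (cmXiTorusChar L v μ η₁ η₂)).IntertwiningMap σ` itself (equivariance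
in its type), `hf0 : f ≠ 0`} and the TARGET LETTER `hσ : «σ has no subrepresentation of class π²(ξ_v)»` (true for the Weyl-conjugate principal series
`i_G(wχ_ξ)` at exponent `−½` — the dual orientation, `πⁿ` sub ∕ `π²` quotient — and for every `πⁿ(ξ_v)`-isotypic target; stated by value here):
* §1 (generic, any commutative ring, any monoid): **`exists_equiv_sub_of_injective`** — an INJECTIVE intertwining map `f : ρ → σ` restricts on every subrepresentation
  `K` of `ρ` to an equivalence `K ≃ f(K)` with a subrepresentation of `σ` (Mathlib `IntertwiningMap.comp ∕ range ∕ ofBijective`, `LinearMap.codRestrict`; no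
  `def` — the inclusion and the corestriction are built inside the proof).
* §2 (the CM data, under `(h : KeysOrientation L)` and the Keys labels): **`not_injective_of_keysOrientation`** — with `hσ`, every intertwining map `f : i_G(χ_ξ) → σ`
  is non-injective (else `f(K) ≅ K ≅ π²` inside `σ`, `K` = ORIENT (iii)'s subspace, contradicting `πs ≠ πn`-free `hσ`); **`localIntertwiner_slot_of_keysOrientation`**
  — with `hσ` and `f ≠ 0`: `f.ker ≠ ⊥ ∧ f.ker ≠ ⊤ ∧ (f.ker ↦ π²) ∧ (i_G(χ_ξ) ⧸ f.ker ↦ πⁿ)` (★ p865001); **`localFactor_letters_of_keysOrientation`** — the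
  three letters of the ★ p864867 slot in its `LinearMap` currency at `Nv := f.toLinearMap`: `Nv ≠ 0 ∧ LinearMap.ker Nv ≠ ⊥ ∧ LinearMap.ker Nv ≠ ⊤`.
LEFT AS LETTERS (the dealer's (M) column; unowned, L): the operator `N_v(z)` with its convergence ∕ holomorphy on `{1 < Re}`, its non-vanishing at `3∕2`, and —
if the target is to be PINNED as `i_G(wχ_ξ)` rather than carried by `hσ` — the dual-orientation named fact at exponent `−½`.
Elaboration: the CM carrier `Gqs L v` vs the matrix carrier of ★ `cmPrincipalSeries` and the `IntertwiningMap`-typed source cost up to 1.6·10⁷ heartbeats per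
statement (★ p865001, measured), hence the section options.
HONEST LABEL: every §2 theorem is CONDITIONAL on the UNPROVED letter `KeysOrientation`; the adapter pays no analytic letter; HC_CM is proved only modulo the 7
printed citations (2 remaining named inputs: hLiu418 = `stmt-HodgeConjecture-24832`, h413 = `stmt-HodgeConjecture-24833`) until rung 0 closes; REL ≠ ★ ≠ BUILT;
count-neutral.

## References
* [MoeglinWaldspurger1995] C. Mœglin, J.-L. Waldspurger, *Spectral Decomposition and Eisenstein Series* (1995), II.1.6–II.1.7, IV.1.9–IV.1.11 (local factors of
  `M(w, π)` and the residue).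
* [Rogawski1990] J. D. Rogawski, Ann. of Math. Stud. 123 (1990), §11.4 p. 164, §12.2 (2) pp. 173–174, §12.3.
* [Keys1984] C. D. Keys, Compositio Math. 51 (1984) 115–130, §7.
* [BorelWallach2000] A. Borel, N. Wallach, 2nd ed. (2000), XI §2.
-/

set_option autoImplicit false
set_option linter.dupNamespace false  -- the mandated namespace `…HodgeConjecture.HodgeConjecture.R90.S8` repeats the summit's segment

noncomputable section

open NumberField IsDedekindDomain MeasureTheory
open Literature.NumberTheory Literature.NumberTheory.Automorphic Literature.NumberTheory.Rogawski1990

namespace Summit.HodgeConjecture.HodgeConjecture.R90.S8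

/-! ## §1 An injective intertwining map carries every subrepresentation onto an equivalent subrepresentation of the target (generic) -/

section Generic

variable {A G V W : Type*} [CommRing A] [Monoid G] [AddCommGroup V] [Module A V] [AddCommGroup W] [Module A W]
  {ρ : Representation A G V} {σ : Representation A G W}

/-- **An INJECTIVE intertwining map `f : ρ → σ` restricts, on every subrepresentation `K` of `ρ`, to an equivalence of `K` with a subrepresentation of `σ`**
(namely `f(K)`: the inclusion `K ↪ ρ` and the corestriction `K → f(K)` are built as intertwining maps inside the proof; Mathlib `IntertwiningMap.comp`, `.range`,
`.ofBijective`, `LinearMap.codRestrict`). [cite: BorelWallach2000, XI §2] -/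
theorem exists_equiv_sub_of_injective (f : ρ.IntertwiningMap σ) (hf : Function.Injective f.toLinearMap) (K : Subrepresentation ρ) :
    ∃ N : Subrepresentation σ, Nonempty (K.toRepresentation.Equiv N.toRepresentation) := by
  -- the inclusion `K ↪ ρ` as an intertwining map, and `f` restricted to `K`
  let ι : K.toRepresentation.IntertwiningMap ρ :=
    LinearMap.intertwiningMap_of_isIntertwiningMap K.toRepresentation ρ K.toSubmodule.subtype (fun _ _ => rfl)
  let fK : K.toRepresentation.IntertwiningMap σ := f.comp ι
  have hfK : ∀ k, fK k = f (k : V) := fun _ => rfl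
  refine ⟨fK.range, ⟨?_⟩⟩
  -- the corestriction of `fK` to its range, as an intertwining map, is bijective
  have hmem : ∀ k : ↥K.toSubmodule, fK.toLinearMap k ∈ fK.range.toSubmodule := fun k => ⟨k, rfl⟩
  let c : K.toRepresentation.IntertwiningMap fK.range.toRepresentation :=
    LinearMap.intertwiningMap_of_isIntertwiningMap K.toRepresentation fK.range.toRepresentation
      (LinearMap.codRestrict fK.range.toSubmodule fK.toLinearMap hmem)
      (fun g k => by
        apply Subtype.ext
        exact Representation.IntertwiningMap.isIntertwining _ _ fK g k)
  refine c.ofBijective ⟨?_, ?_⟩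
  · intro k₁ k₂ hk
    have hk' : fK k₁ = fK k₂ := congrArg Subtype.val hk
    rw [hfK, hfK] at hk'
    exact Subtype.ext (hf hk')
  · rintro ⟨w, ⟨k, hk⟩⟩
    exact ⟨k, Subtype.ext hk⟩

end Generic

/-! ## §2 The adapter at the data of Keys' case (2): non-injectivity, the slot's three letters, kernel and quotient -/

section Consumer

set_option synthInstance.maxHeartbeats 400000
set_option maxHeartbeats 16000000 -- section-local («measured», ★ p865001 `intertwiningMap_ker_quotient_of_keysOrientation`): the CM carrier `Gqs L v` vs the matrix carrier of ★ `cmPrincipalSeries` and the `IntertwiningMap`-typed source; default 2·10⁵ and 4·10⁶ are RED at `isDefEq`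

variable {L : Type} [Field L] [NumberField L] [IsCMField L]
  (h : KeysOrientation L) {v : HeightOneSpectrum (𝓞 ↥(maximalRealSubfield L))}
  (hns : ∀ w : UnitaryGroup.PlacesOver L v, IsCMField.complexConj L • w.1 = w.1)
  {μ : (UnitaryGroup.LocalRing L v)ˣ →* ℂˣ}
  {η₁ η₂ : ↥(UnitaryGroup.normOneUnits (UnitaryGroup.conjLocal L (IsCMField.complexConj L) v)) →* ℂˣ}
  (hμ : UnitaryGroup.IsQuadraticCharExtension (UnitaryGroup.conjLocal L (IsCMField.complexConj L) v) μ)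
  (hμc : Continuous (fun x => ((μ x : ℂˣ) : ℂ))) (h1c : Continuous (fun x => ((η₁ x : ℂˣ) : ℂ)))
  (h2c : Continuous (fun x => ((η₂ x : ℂˣ) : ℂ)))
  [MeasurableSpace (Gqs L v ⧸ Subgroup.center (Gqs L v))] [BorelSpace (Gqs L v ⧸ Subgroup.center (Gqs L v))]
  (μZ : Measure (Gqs L v ⧸ Subgroup.center (Gqs L v))) [μZ.IsHaarMeasure]
  {πs πn : IrrClass (Gqs L v)} (hK : KeysCaseTwoLabels L v μ η₁ η₂ πs πn)
  (hs : πs.IsSquareIntegrable μZ) (hn : ¬ πn.IsSquareIntegrable μZ)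
  {W : Type*} [AddCommGroup W] [Module ℂ W]
  {σ : Representation ℂ ↥(unitaryGroupOfForm (UnitaryGroup.conjLocal L (IsCMField.complexConj L) v) (UnitaryGroup.cmLocalForm L 3 v)) W}
  (f : (UnitaryGroup.cmPrincipalSeries L 3 v (UnitaryGroup.cmXiTorusChar L v μ η₁ η₂)).IntertwiningMap σ)
  -- THE TARGET LETTER: `σ` has no subrepresentation of class `π²(ξ_v)` (e.g. `σ = i_G(wχ_ξ)` by the dual orientation, or any `πⁿ`-isotypic target)
  (hσ : ∀ (r : SmoothIrrep (Gqs L v)) (N' : Subrepresentation σ), Nonempty (r.ρ.Equiv N'.toRepresentation) → IrrClass.mk r ≠ πs)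

include h hns hμ hμc h1c h2c hK hs hn hσ

/-- **NON-INJECTIVITY OF THE LOCAL INTERTWINER** — every intertwining map `f : i_G(χ_ξ) → σ` into a target WITHOUT a subrepresentation of class `π²(ξ_v)` fails to be
injective: otherwise `f` carries ORIENT (iii)'s subspace `K ≅ π²(ξ_v)` onto an equivalent subrepresentation `f(K) ≤ σ` (§1), contradicting `hσ`.  This is the algebraic
half of «`⊥ ≠ ker N_v(3∕2)`» at a ramified place; the analytic input is only that `N_v(3∕2)` exists as a `G_v`-map into such a target.
[cite: Rogawski1990, §11.4 p. 164; §12.2 (2) pp. 173–174; §12.3] [cite: Keys1984, §7] [cite: MoeglinWaldspurger1995, IV.1.9–IV.1.11] -/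
theorem not_injective_of_keysOrientation : ¬ Function.Injective f.toLinearMap := by
  intro hinj
  obtain ⟨K, -, ⟨r, hr, ⟨e⟩⟩, -⟩ := (h v hns μ η₁ η₂ hμ hμc h1c h2c μZ πs πn hK hs hn).2.2
  obtain ⟨N', ⟨e'⟩⟩ := exists_equiv_sub_of_injective f hinj K
  exact hσ r N' ⟨e.trans e'⟩ hr

/-- **THE SLOT AT A RAMIFIED PLACE** — for a NON-ZERO intertwining map `f : i_G(χ_ξ) → σ` (the residual-point local factor `N_v(3∕2)`, letter `hf0`) into a target
without `π²(ξ_v)`-subrepresentations (letter `hσ`): `f.ker ≠ ⊥`, `f.ker ≠ ⊤`, `f.ker` carries `π²(ξ_v)` and `i_G(χ_ξ) ⧸ f.ker` carries `πⁿ(ξ_v)` (★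
`intertwiningMap_ker_quotient_of_keysOrientation`). [cite: MoeglinWaldspurger1995, II.1.6–II.1.7, IV.1.9–IV.1.11] [cite: Rogawski1990, §12.2 (2) pp. 173–174] [cite: Keys1984, §7] -/
theorem localIntertwiner_slot_of_keysOrientation (hf0 : f.toLinearMap ≠ 0) :
    f.ker ≠ ⊥ ∧ f.ker ≠ ⊤ ∧
    (∃ r : SmoothIrrep (Gqs L v), IrrClass.mk r = πs ∧ Nonempty (r.ρ.Equiv f.ker.toRepresentation)) ∧
    (∃ r : SmoothIrrep (Gqs L v), IrrClass.mk r = πn ∧ Nonempty (r.ρ.Equiv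
      ((UnitaryGroup.cmPrincipalSeries L 3 v (UnitaryGroup.cmXiTorusChar L v μ η₁ η₂)).quotient f.ker.toSubmodule
        fun g _ hx => f.ker.apply_mem_toSubmodule g hx))) := by
  have hinj : ¬ Function.Injective f.toLinearMap := not_injective_of_keysOrientation h hns hμ hμc h1c h2c μZ hK hs hn f hσ
  have hkq := intertwiningMap_ker_quotient_of_keysOrientation h hns hμ hμc h1c h2c μZ hK hs hn f hinj hf0
  exact ⟨ker_ne_bot_of_not_injective f hinj, ker_ne_top_of_ne_zero f hf0, hkq.1, hkq.2⟩

/-- **THE THREE LETTERS OF THE ★ `R90S8IntertwiningResidueKernelOfFactorisationU3` SLOT IN ITS `LinearMap` CURRENCY** at `Nv := f.toLinearMap`: `Nv ≠ 0`,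
`LinearMap.ker Nv ≠ ⊥`, `LinearMap.ker Nv ≠ ⊤` — for a non-zero local factor into a target without `π²(ξ_v)`-subrepresentations.
[cite: MoeglinWaldspurger1995, IV.1.9–IV.1.11] [cite: Rogawski1990, §12.2 (2) pp. 173–174] -/
theorem localFactor_letters_of_keysOrientation (hf0 : f.toLinearMap ≠ 0) :
    f.toLinearMap ≠ 0 ∧ LinearMap.ker f.toLinearMap ≠ ⊥ ∧ LinearMap.ker f.toLinearMap ≠ ⊤ := by
  have hinj : ¬ Function.Injective f.toLinearMap := not_injective_of_keysOrientation h hns hμ hμc h1c h2c μZ hK hs hn f hσ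
  refine ⟨hf0, fun hb => hinj (LinearMap.ker_eq_bot.mp hb), fun ht => hf0 (LinearMap.ker_eq_top.mp ht)⟩

end Consumer

end Summit.HodgeConjecture.HodgeConjecture.R90.S8

end
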